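import Summits.BirchSwinnertonDyer.BirchSwinnertonDyer.Theorems.GenusKolyvaginAtTwoPowDvdShaCardAtTwoRTDeepOwnPrimeCondition
import Summits.BirchSwinnertonDyer.BirchSwinnertonDyer.Theorems.ByReductionTypeAtTwoRankOneAtTwoOffBigImageOddLocalEngineRegularLocalStructure
import HarnessLib

/-!
# Route `GenusKolyvaginAtTwo`, crux L⁺_T `PowDvdShaCardAtTwoPosT` (stmt-BirchSwinnertonDyer-23379), road «E4⁺», socket hbot⁺ (LEAD R10″) —
# LAYER 2 OF THE BOTTOM RUNG AT TRANSPOSITION-DEEP PRIMES: the local count `#H¹(ℚ_ℓ, E[2^M]) = 4^M`, the order-`4` auxiliary class under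
# local conditions, and the order-`≥ 8` condition at a deep own prime — at REGULAR primes (no sign condition on `Δ`)

Seat `bsd-line-gk2-p4` g24 (WIDTH-5 attach, cell `bsd-f1-sign2`), `--supports stmt-BirchSwinnertonDyer-23379 --as helper`.
THEOREMS ONLY (no definition, no named fact, no `sorry`).  BSD is NOT proved by any of this; L⁺_T / Q4_T are NOT claimed; nothing is closed.

WHY.  The auxiliary class `y` of LEAD g16/g17's bottom-rung engine (`…RTOrderFourAuxiliary{,Constrained,Deep}`, `…RTDeepOwnPrimeCondition`,
width seats gk2-p4 g18/g19) depends on `Δ < 0` and Gross's (3.2) through ONE local leaf only: the count `#H¹(ℚ_ℓ, E[2^M]) = 4^M` at a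
Gross–Kolyvagin prime of index `≥ M` (`natCard_galoisCohomology_one_toLocal_two_pow_eq`, from `#E(ℚ_ℓ)[2^M] = 2^M`).  At a REGULAR Kolyvagin
prime (some Frobenius above `ℓ` an involution of `E[2]` moving a `2`-torsion point) the sibling route's engine already proves
`#E(ℚ_ℓ)[2^M] = 2^M` (`OffBigImageOddLocalAtTwo.Engine.natCard_ker_zsmul_adicCompletion_two_pow_eq_regular`, any sign of `Δ`).  THIS FILE re-threads
the auxiliary layer over it, statements VERBATIM with `(hΔ : W.Δ < 0)` deleted and `FrobEqFrobInfty W K 2 ℓ` replaced by the regular clause at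
the place (the field `K` then drops out of the hypotheses):
* §1 `natCard_galoisCohomology_one_toLocal_two_pow_eq_regular`;
* §2 `exists_mem_kummerOutside_four_two_nsmul_ne_zero_of_card_regular`, `…_of_free_of_eight_le_regular` (gk2-p4 g18's `…Constrained`);
* §3 `exists_localCondition_eight_le_rat_regular` and the `∀`-Frobenius form `exists_localCondition_eight_le_forall_regular` with the
  transversality of `2•Z` quantified over EVERY Frobenius above the place (no complex conjugation `c₀`: at a transposition-deep prime every
  Frobenius is regular on `E[4]`, and the Frobenius at the prime of the chosen embedding exists unconditionally).
The deep auxiliary `exists_auxiliary_four_two_nsmul_ne_zero_deep` / `exists_auxiliary_bottomRung` and the engine follow in the next layer.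

HONEST FRAMING.  Ports of landed theorems (LEAD g16, gk2-p4 g18/g19) over the sibling route's regular local structure; closes nothing; BSD is not proved.

References: [McCallumLMS1991] §2 Prop. 2.1, §5 Lemma 5.3 and proof of Prop. 5.2 (13); [MilneADT2006] I Thm. 2.8, Cor. 2.3, Cor. 3.4, Thm. 4.10;
[GrossLMS1991] §3 (3.1)–(3.3).
-/

set_option autoImplicit false
-- the Theorems namespace of this sub repeats the summit name by design (D-0017 nested layout)
set_option linter.dupNamespace false

noncomputable section

open scoped Classical

open CategoryTheory Field NumberField IsDedekindDomain Function
open _root_.WeierstrassCurve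
open Literature.NumberTheory.EllipticCurves
open Literature.NumberTheory.GaloisRepresentations
open Literature.NumberTheory.GaloisCohomology
open Summit.BirchSwinnertonDyer.Rank1Residual.X11b.KummerPT
open Summit.BirchSwinnertonDyer.Rank1Residual.X11b.FiniteDuality
open Summit.BirchSwinnertonDyer.Rank1Residual.X11b.Relaxation
open Summit.BirchSwinnertonDyer.Rank1Residual.X11b.LocBridge Summit.BirchSwinnertonDyer.Rank1Residual.X11b.Levels
open scoped ContRepresentation

namespace Summit.BirchSwinnertonDyer.BirchSwinnertonDyer.Theorems.GenusExact.RelaxedCount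

open Summit.BirchSwinnertonDyer.BirchSwinnertonDyer.Theorems.GenusExact.ReductionCyclic
open Summit.BirchSwinnertonDyer.BirchSwinnertonDyer.Theorems.GenusExact.LocalDualityOrder
open Summit.BirchSwinnertonDyer.BirchSwinnertonDyer.Theorems.GenusExact.DeepOwnPrime
open Summit.BirchSwinnertonDyer.BirchSwinnertonDyer.Theorems.OffBigImageOddLocalAtTwo.Engine (natCard_ker_zsmul_adicCompletion_two_pow_eq_regular)

variable (W : WeierstrassCurve ℚ) [W.IsElliptic] [W.IsGloballyMinimal]

/-! ## §1 The local count at a regular Kolyvagin prime -/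

/-- **`#H¹(ℚ_ℓ, E[2^M]) = 4^M` at a REGULAR Kolyvagin prime of index `≥ M`** (`ℓ ≠ 2` of good reduction, some Frobenius above `ℓ` an involution of
`E[2]` moving a `2`-torsion point, `1 ≤ M ≤ kolyvaginIndex`; any sign of `Δ`): LEAD's `natCard_galoisCohomology_one_toLocal_two_pow_eq` over the
sibling engine's `natCard_ker_zsmul_adicCompletion_two_pow_eq_regular`. [cite: McCallumLMS1991, §5 Lemma 5.3] [cite: MilneADT2006, Ch. I, Thm. 2.8] -/
theorem natCard_galoisCohomology_one_toLocal_two_pow_eq_regular {ℓ : ℕ} [Fact ℓ.Prime] (hℓ2 : ℓ ≠ 2)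
    (hgoodℓ : W.HasGoodReductionAtPrime ℓ) {v : HeightOneSpectrum (𝓞 ℚ)} (hv : (ℓ : 𝓞 ℚ) ∈ v.asIdeal)
    (hreg : ∃ (𝔓 : Ideal (absIntegers (𝓞 ℚ) ℚ)) (h : absoluteGaloisGroup ℚ), 𝔓 ∈ v.primesAbove ∧
      IsArithFrobAt (𝓞 ℚ) h 𝔓 ∧ (∀ P : geomTorsion W ((2 : ℕ) : ℤ), h • h • P = P) ∧
      ∃ u : geomTorsion W ((2 : ℕ) : ℤ), h • u ≠ u)
    {M : ℕ} (hM0 : M ≠ 0) (hM : M ≤ Zhang2014.kolyvaginIndex W 2 ℓ) :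
    Nat.card (galoisCohomology ((W.torsionGaloisModule ((2 ^ M : ℕ) : ℤ)).toLocal (Sum.inr v)) 1) = 4 ^ M := by
  -- (adapted from LEAD g16 `natCard_galoisCohomology_one_toLocal_two_pow_eq`)
  haveI : Fact (Nat.Prime 2) := ⟨Nat.prime_two⟩
  have h := natCard_galoisCohomology_one_torsion_eq_sq_of_not_mem v W hM0 (two_notMem_of_odd_prime_mem hℓ2 hv)
  have hker : Nat.card (nsmulAddMonoidHom (2 ^ M) :
      (W.baseChange (v.adicCompletion ℚ)).toAffine.Point →+ _).ker = 2 ^ M := by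
    rw [← zsmulAddGroupHom_natCast]
    exact natCard_ker_zsmul_adicCompletion_two_pow_eq_regular W hℓ2 hgoodℓ hv hreg hM
  rw [hker, ← pow_mul, mul_comm, pow_mul] at h
  exact h

/-! ## §2 The order-4 auxiliary class under local conditions on `T`, regular places -/

/-- **The order-4 auxiliary class under ARBITRARY local conditions on `T`, at REGULAR places** — gk2-p4 g18's
`exists_mem_kummerOutside_four_two_nsmul_ne_zero_of_card` with `Δ < 0` deleted and `FrobEqFrobInfty W K 2 ℓ` ↦ the regular clause at each place
of `T`: `M_u ≤ H¹(ℚ_u, E[4])` with `8^{#T} < ∏ #M_u` ⟹ `∃ y ∈ H¹_{𝓛, ⊤ on T}(ℚ, E[4])`, `loc_u y ∈ M_u`, `2•y ≠ 0`.  Proof verbatim over §1.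
[cite: McCallumLMS1991, §2 Prop. 2.1 and §5 proof of Prop. 5.2] [cite: MilneADT2006, Ch. I, Thm. 4.10] -/
theorem exists_mem_kummerOutside_four_two_nsmul_ne_zero_of_card_regular (hρ2 : W.HasSurjectiveModNGaloisRep 2)
    (T : Finset (Place ℚ))
    (hTK : ∀ u ∈ T, ∃ (v : HeightOneSpectrum (𝓞 ℚ)) (ℓ : ℕ) (_ : Fact ℓ.Prime), u = Sum.inr v ∧ ℓ ≠ 2 ∧ (ℓ : 𝓞 ℚ) ∈ v.asIdeal ∧
      W.HasGoodReductionAtPrime ℓ ∧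
      (∃ (𝔓 : Ideal (absIntegers (𝓞 ℚ) ℚ)) (h : absoluteGaloisGroup ℚ), 𝔓 ∈ v.primesAbove ∧
        IsArithFrobAt (𝓞 ℚ) h 𝔓 ∧ (∀ P : geomTorsion W ((2 : ℕ) : ℤ), h • h • P = P) ∧
        ∃ u : geomTorsion W ((2 : ℕ) : ℤ), h • u ≠ u) ∧
      2 ≤ Zhang2014.kolyvaginIndex W 2 ℓ)
    (M : ∀ u : ↥T, AddSubgroup (galoisCohomology ((W.torsionGaloisModule ((2 ^ 2 : ℕ) : ℤ)).toLocal (u : Place ℚ)) 1))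
    (hM : 8 ^ T.card < ∏ u : ↥T, Nat.card (M u)) :
    ∃ y ∈ kummerOutside W (2 ^ 2) T,
      (∀ u : ↥T, galoisCohomology.localization (W.torsionGaloisModule ((2 ^ 2 : ℕ) : ℤ)) (u : Place ℚ) 1 y ∈ M u) ∧
        2 • y ≠ 0 := by
  -- (adapted from gk2-p4 g18 `exists_mem_kummerOutside_four_two_nsmul_ne_zero_of_card`)
  classical
  haveI : Fact (Nat.Prime 2) := ⟨Nat.prime_two⟩
  -- local counts on `T`
  have hcount : ∀ (N : ℕ), N ≠ 0 → N ≤ 2 → ∀ u : ↥T,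
      Nat.card (galoisCohomology ((W.torsionGaloisModule ((2 ^ N : ℕ) : ℤ)).toLocal (u : Place ℚ)) 1) = 4 ^ N := by
    intro N hN0 hN2 u
    obtain ⟨v, ℓ, hℓp, hu, hℓ2, hv, hgood, hFrob, hidx⟩ := hTK u u.2
    rw [hu]
    exact natCard_galoisCohomology_one_toLocal_two_pow_eq_regular W hℓ2 hgood hv hFrob hN0 (hN2.trans hidx)
  -- Weil pairings at levels 2 and 4
  obtain ⟨e₂, hμ₂, hadd₁₂, hadd₂₂, halt₂, hnondeg₂, hgal₂⟩ :=
    W.exists_weilPairing_holds (2 ^ 1) (by norm_num) (by norm_num)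
  obtain ⟨e₄, hμ₄, hadd₁₄, hadd₂₄, halt₄, hnondeg₄, hgal₄⟩ :=
    W.exists_weilPairing_holds (2 ^ 2) (by norm_num) (by norm_num)
  -- product localisations
  set loc₂ : galoisCohomology (W.torsionGaloisModule ((2 ^ 1 : ℕ) : ℤ)) 1 →+
      (∀ u : ↥T, galoisCohomology ((W.torsionGaloisModule ((2 ^ 1 : ℕ) : ℤ)).toLocal (u : Place ℚ)) 1) :=
    AddMonoidHom.pi fun u ↦ galoisCohomology.localization (W.torsionGaloisModule ((2 ^ 1 : ℕ) : ℤ)) (u : Place ℚ) 1 with hloc₂d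
  set loc₄ : galoisCohomology (W.torsionGaloisModule ((2 ^ 2 : ℕ) : ℤ)) 1 →+
      (∀ u : ↥T, galoisCohomology ((W.torsionGaloisModule ((2 ^ 2 : ℕ) : ℤ)).toLocal (u : Place ℚ)) 1) :=
    AddMonoidHom.pi fun u ↦ galoisCohomology.localization (W.torsionGaloisModule ((2 ^ 2 : ℕ) : ℤ)) (u : Place ℚ) 1 with hloc₄d
  have hloc₂ : ∀ c u, loc₂ c u = galoisCohomology.localization (W.torsionGaloisModule ((2 ^ 1 : ℕ) : ℤ)) (u : Place ℚ) 1 c :=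
    fun c u ↦ rfl
  have hloc₄ : ∀ c u, loc₄ c u = galoisCohomology.localization (W.torsionGaloisModule ((2 ^ 2 : ℕ) : ℤ)) (u : Place ℚ) 1 c :=
    fun c u ↦ rfl
  -- the level map
  have hdvd : ((2 ^ 1 : ℕ) : ℤ) ∣ ((2 ^ (1 + 1) : ℕ) : ℤ) := by norm_num
  have hι : Injective (galoisCohomology.map (W.torsionInclusion hdvd) 1) := by
    intro x y hxy
    rw [map_torsionInclusion_one_apply, map_torsionInclusion_one_apply] at hxy
    exact VisiblePairAtTwo.torsionH1OfDvd_pow_injective W (p := 2) (VisiblePairAtTwo.torsionBy_two_eq_bot_of_surj W hρ2) hdvd hxy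
  -- the numerical hypothesis: `∏ 4 · ∏ 16 = (8 ^ #T)² < (∏ #M_u)²`
  have h2 : ∀ u : ↥T, Nat.card (galoisCohomology ((W.torsionGaloisModule ((2 ^ 1 : ℕ) : ℤ)).toLocal (u : Place ℚ)) 1) = 4 :=
    fun u ↦ by rw [hcount 1 one_ne_zero (by norm_num) u, pow_one]
  have h4 : ∀ u : ↥T, Nat.card (galoisCohomology ((W.torsionGaloisModule ((2 ^ (1 + 1) : ℕ) : ℤ)).toLocal (u : Place ℚ)) 1) =
      16 := fun u ↦ by rw [hcount (1 + 1) (by norm_num) le_rfl u]; norm_num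
  have hlt : (∏ u : ↥T, Nat.card (galoisCohomology ((W.torsionGaloisModule ((2 ^ 1 : ℕ) : ℤ)).toLocal (u : Place ℚ)) 1)) *
      (∏ u : ↥T, Nat.card (galoisCohomology ((W.torsionGaloisModule ((2 ^ (1 + 1) : ℕ) : ℤ)).toLocal (u : Place ℚ)) 1)) <
      (∏ u : ↥T, Nat.card (M u)) ^ 2 := by
    rw [Finset.prod_congr rfl fun u _ ↦ h2 u, Finset.prod_congr rfl fun u _ ↦ h4 u, Finset.prod_const, Finset.prod_const,
      Finset.card_univ, Fintype.card_coe, ← mul_pow]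
    have h64 : (4 * 16) ^ T.card = (8 ^ T.card) ^ 2 := by rw [sq, ← mul_pow]; norm_num
    rw [h64]
    exact Nat.pow_lt_pow_left hM two_ne_zero
  obtain ⟨y, hy, hy2⟩ := exists_mem_solutions_nsmul_ne_zero_canonical W 2 1 (1 + 1) e₂ hμ₂ hadd₁₂ hadd₂₂ hgal₂ halt₂ hnondeg₂
    e₄ hμ₄ hadd₁₄ hadd₂₄ hgal₄ halt₄ hnondeg₄ one_pos (by norm_num) 2 T loc₂ hloc₂ loc₄ hloc₄
    (galoisCohomology.map (W.torsionInclusion hdvd) 1) hι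
    (fun c hc ↦ (map_torsionInclusion_mem_kummerOutside_iff W hdvd T c).mpr hc)
    (fun y hyT hy ↦ exists_map_torsionInclusion_eq_of_mem_kummerOutside W 2
      (VisiblePairAtTwo.torsionBy_two_eq_bot_of_surj W hρ2) 1 1 hdvd T y hyT (by simpa using hy))
    (fun c u hc ↦ by
      rw [hloc₄]
      exact localization_map_torsionInclusion_eq_zero W hdvd (u : Place ℚ) c (by rw [← hloc₂]; exact hc))
    M hlt
  have hyM : y ∈ (AddSubgroup.pi Set.univ M).comap loc₄ := (AddSubgroup.mem_inf.mp hy).2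
  rw [AddSubgroup.mem_comap, AddSubgroup.mem_pi] at hyM
  refine ⟨y, (AddSubgroup.mem_inf.mp hy).1, fun u ↦ ?_, hy2⟩
  rw [← hloc₄]
  exact hyM u (Set.mem_univ _)

/-- **The S-bot corollary at regular places**: `M_u = ⊤` at some `u₀ ∈ T` and `8 ≤ #M_u` on `T` ⟹ `∃ y ∈ H¹_{𝓛, ⊤ on T}(ℚ, E[4])` with
`loc_u y ∈ M_u` and `2•y ≠ 0` (gk2-p4 g18's `…_of_free_of_eight_le`, regular places). [cite: McCallumLMS1991, §5 proof of Prop. 5.2] -/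
theorem exists_mem_kummerOutside_four_two_nsmul_ne_zero_of_free_of_eight_le_regular (hρ2 : W.HasSurjectiveModNGaloisRep 2)
    (T : Finset (Place ℚ))
    (hTK : ∀ u ∈ T, ∃ (v : HeightOneSpectrum (𝓞 ℚ)) (ℓ : ℕ) (_ : Fact ℓ.Prime), u = Sum.inr v ∧ ℓ ≠ 2 ∧ (ℓ : 𝓞 ℚ) ∈ v.asIdeal ∧
      W.HasGoodReductionAtPrime ℓ ∧
      (∃ (𝔓 : Ideal (absIntegers (𝓞 ℚ) ℚ)) (h : absoluteGaloisGroup ℚ), 𝔓 ∈ v.primesAbove ∧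
        IsArithFrobAt (𝓞 ℚ) h 𝔓 ∧ (∀ P : geomTorsion W ((2 : ℕ) : ℤ), h • h • P = P) ∧
        ∃ u : geomTorsion W ((2 : ℕ) : ℤ), h • u ≠ u) ∧
      2 ≤ Zhang2014.kolyvaginIndex W 2 ℓ)
    (M : ∀ u : ↥T, AddSubgroup (galoisCohomology ((W.torsionGaloisModule ((2 ^ 2 : ℕ) : ℤ)).toLocal (u : Place ℚ)) 1))
    (hfree : ∃ u₀ : ↥T, M u₀ = ⊤) (h8 : ∀ u : ↥T, 8 ≤ Nat.card (M u)) :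
    ∃ y ∈ kummerOutside W (2 ^ 2) T,
      (∀ u : ↥T, galoisCohomology.localization (W.torsionGaloisModule ((2 ^ 2 : ℕ) : ℤ)) (u : Place ℚ) 1 y ∈ M u) ∧
        2 • y ≠ 0 := by
  classical
  obtain ⟨u₀, hu₀⟩ := hfree
  have h16 : Nat.card (M u₀) = 16 := by
    obtain ⟨v, ℓ, hℓp, hu, hℓ2, hv, hgood, hFrob, hidx⟩ := hTK u₀ u₀.2
    rw [hu₀, AddSubgroup.card_top]
    have h := natCard_galoisCohomology_one_toLocal_two_pow_eq_regular W hℓ2 hgood hv hFrob two_ne_zero hidx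
    rw [← hu] at h
    rw [h]; norm_num
  have hM : 8 ^ T.card < ∏ u : ↥T, Nat.card (M u) := by
    have h := eight_pow_card_lt_prod_of_free_of_eight_le (fun u : ↥T ↦ Nat.card (M u)) h8 h16
    rwa [Fintype.card_coe] at h
  exact exists_mem_kummerOutside_four_two_nsmul_ne_zero_of_card_regular W hρ2 T hTK M hM

/-! ## §3 The order-`≥ 8` local condition at a regular deep own prime -/

section Deep

variable (e : geomTorsion W ((2 ^ 2 : ℕ) : ℤ) → geomTorsion W ((2 ^ 2 : ℕ) : ℤ) → AlgebraicClosure ℚ)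
  (hμ : ∀ S T, e S T ^ (2 ^ 2) = 1)
  (hadd₁ : ∀ S₁ S₂ T, e (S₁ + S₂) T = e S₁ T * e S₂ T)
  (hadd₂ : ∀ S T₁ T₂, e S (T₁ + T₂) = e S T₁ * e S T₂)
  (hgal : ∀ (σ : absoluteGaloisGroup ℚ) (S T : geomTorsion W ((2 ^ 2 : ℕ) : ℤ)), σ • e S T = e (σ • S) (σ • T))
  (halt : ∀ T, e T T = 1) (hnondeg : ∀ T, (∀ S, e S T = 1) → T = 0)
  (inv : LocalInvariants ℚ (2 ^ 2))

include halt hnondeg in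
/-- **The local condition at a REGULAR deep own prime over `ℚ`, fixed Frobenius** — gk2-p4 g19's `exists_localCondition_eight_le_rat` with
`(hΔ, FrobEqFrobInfty W K 2 ℓ)` ↦ the regular clause (only the count `#H¹(ℚ_ℓ, E[4]) = 16` is needed): `∃ M ≤ H¹(ℚ_ℓ, E[4])`, `8 ≤ #M`, killing
`inv_ℓ(loc_ℓ(2•Z) ∪ₑ ·)` for every global `Z` with `[2•Z, F] ∈ (F − 1)E[4]`. [cite: McCallumLMS1991, §5 Lemma 5.3 and proof of Prop. 5.2 (13)]
[cite: MilneADT2006, Ch. I, Cor. 2.3, Thm. 2.8] -/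
theorem exists_localCondition_eight_le_rat_regular
    {ℓ : ℕ} [Fact ℓ.Prime] (hℓ2 : ℓ ≠ 2) (hgoodℓ : W.HasGoodReductionAtPrime ℓ)
    {v : HeightOneSpectrum (𝓞 ℚ)} (hv : (ℓ : 𝓞 ℚ) ∈ v.asIdeal)
    (hreg : ∃ (𝔓 : Ideal (absIntegers (𝓞 ℚ) ℚ)) (h : absoluteGaloisGroup ℚ), 𝔓 ∈ v.primesAbove ∧
      IsArithFrobAt (𝓞 ℚ) h 𝔓 ∧ (∀ P : geomTorsion W ((2 : ℕ) : ℤ), h • h • P = P) ∧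
      ∃ u : geomTorsion W ((2 : ℕ) : ℤ), h • u ≠ u)
    (hidx : 2 ≤ Zhang2014.kolyvaginIndex W 2 ℓ)
    (hinv : Injective (inv (Sum.inr v)))
    {𝔐 : Ideal (HeightOneSpectrum.localAbsIntegers v)} (h𝔐 : 𝔐 ∈ v.localPrimesAbove)
    {F : absoluteGaloisGroup ℚ}
    (hF : IsArithFrobAt (𝓞 ℚ) F (v.primeBelow (closureEmb (K := ℚ) (v.adicCompletion ℚ)) 𝔐)) :
    ∃ M : AddSubgroup (galoisCohomology ((W.torsionGaloisModule ((2 ^ 2 : ℕ) : ℤ)).toLocal (Sum.inr v)) 1),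
      8 ≤ Nat.card M ∧
      ∀ Z : galoisCohomology (W.torsionGaloisModule ((2 ^ 2 : ℕ) : ℤ)) 1,
        (∃ P : geomTorsion W ((2 ^ 2 : ℕ) : ℤ), h1Eval W _ ((2 : ℕ) • Z) F = F • P - P) →
        ∀ m ∈ M, invWeilPairing W (2 ^ 2) e hμ hadd₁ hadd₂ hgal inv (Sum.inr v)
          (galoisCohomology.localization (W.torsionGaloisModule ((2 ^ 2 : ℕ) : ℤ)) (Sum.inr v) 1 ((2 : ℕ) • Z)) m = 0 := by
  have hgood : W.HasGoodReductionAt v := W.hasGoodReductionAt_of_hasGoodReductionAtPrime v hv hgoodℓ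
  have h2v : ((2 : ℕ) : 𝓞 ℚ) ∉ v.asIdeal := LocalDualityOrder.two_notMem_of_odd_prime_mem hℓ2 hv
  have hV : Nat.card (galoisCohomology ((W.torsionGaloisModule ((2 ^ 2 : ℕ) : ℤ)).toLocal (Sum.inr v)) 1) = 16 := by
    rw [natCard_galoisCohomology_one_toLocal_two_pow_eq_regular W hℓ2 hgoodℓ hv hreg two_ne_zero hidx]; norm_num
  exact exists_localCondition_eight_le_of_frobenius W v e hμ hadd₁ hadd₂ hgal halt hnondeg inv hgood h2v hinv hV h𝔐 hF

include halt hnondeg in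
/-- **The local condition at a REGULAR deep own prime over `ℚ`, `∀`-Frobenius form** — gk2-p4 g19's `exists_localCondition_eight_le_forall`
at a regular prime, with the transversality of `2•Z` quantified over EVERY prime `𝔓 ∣ v` and EVERY arithmetic Frobenius `F` there
(`[2•Z, F] ∈ (F − 1)E[4]`; no complex conjugation: at a transposition-deep prime every Frobenius is regular on `E[4]`); the Frobenius at the
prime of the chosen embedding exists unconditionally (`exists_isArithFrobAt_of_mem_primesAbove`). [cite: McCallumLMS1991, §5 Lemma 5.3 and proof of Prop. 5.2 (13)] -/
theorem exists_localCondition_eight_le_forall_regular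
    {ℓ : ℕ} [Fact ℓ.Prime] (hℓ2 : ℓ ≠ 2) (hgoodℓ : W.HasGoodReductionAtPrime ℓ)
    {v : HeightOneSpectrum (𝓞 ℚ)} (hv : (ℓ : 𝓞 ℚ) ∈ v.asIdeal)
    (hreg : ∃ (𝔓 : Ideal (absIntegers (𝓞 ℚ) ℚ)) (h : absoluteGaloisGroup ℚ), 𝔓 ∈ v.primesAbove ∧
      IsArithFrobAt (𝓞 ℚ) h 𝔓 ∧ (∀ P : geomTorsion W ((2 : ℕ) : ℤ), h • h • P = P) ∧
      ∃ u : geomTorsion W ((2 : ℕ) : ℤ), h • u ≠ u)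
    (hidx : 2 ≤ Zhang2014.kolyvaginIndex W 2 ℓ)
    (hinv : Injective (inv (Sum.inr v))) :
    ∃ M : AddSubgroup (galoisCohomology ((W.torsionGaloisModule ((2 ^ 2 : ℕ) : ℤ)).toLocal (Sum.inr v)) 1),
      8 ≤ Nat.card M ∧
      ∀ Z : galoisCohomology (W.torsionGaloisModule ((2 ^ 2 : ℕ) : ℤ)) 1,
        (∀ 𝔓 ∈ v.primesAbove, ∀ F : absoluteGaloisGroup ℚ, IsArithFrobAt (𝓞 ℚ) F 𝔓 →
          ∃ P₁ : geomTorsion W ((2 ^ 2 : ℕ) : ℤ), h1Eval W _ ((2 : ℕ) • Z) F = F • P₁ - P₁) →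
        ∀ m ∈ M, invWeilPairing W (2 ^ 2) e hμ hadd₁ hadd₂ hgal inv (Sum.inr v)
          (galoisCohomology.localization (W.torsionGaloisModule ((2 ^ 2 : ℕ) : ℤ)) (Sum.inr v) 1 ((2 : ℕ) • Z)) m = 0 := by
  obtain ⟨𝔐, h𝔐⟩ := v.localPrimesAbove_nonempty
  set 𝔓 := v.primeBelow (closureEmb (K := ℚ) (v.adicCompletion ℚ)) 𝔐 with h𝔓def
  have h𝔓 : 𝔓 ∈ v.primesAbove := HeightOneSpectrum.primeBelow_mem_primesAbove h𝔐
  obtain ⟨F, hFrob⟩ := HeightOneSpectrum.exists_isArithFrobAt_of_mem_primesAbove_holds h𝔓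
  obtain ⟨M, hM8, hM⟩ := exists_localCondition_eight_le_rat_regular W e hμ hadd₁ hadd₂ hgal halt hnondeg inv hℓ2 hgoodℓ hv hreg hidx
    hinv h𝔐 hFrob
  exact ⟨M, hM8, fun Z hZ m hm ↦ hM Z (hZ 𝔓 h𝔓 F hFrob) m hm⟩

end Deep

end Summit.BirchSwinnertonDyer.BirchSwinnertonDyer.Theorems.GenusExact.RelaxedCount

end
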